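import Summits.Ventures.WeilGRH.MinorantZetaTransferOddRungs
import Summits.Ventures.WeilGRH.GL2LevelLawParityRungs
import Summits.RiemannHypothesis.RiemannHypothesis.Theorems.GroundBartaEvenWinsBeyondArchEndpointLog5Half
import HarnessLib

/-!
# GRH arm (rh-explicit, venture WeilGRH): the `(log 5)/2` column — the `ζ` three-prime window rung discharged

Cell `rh-explicit`, WEIL TRACK — GRH ARM (weil-grh-2 gen7).  The `ζ` track's ENDPOINT rung
`EvenWinsBeyondArch.weilPositivityOn_log5half : WeilPositivityOn ((log 5)/2)` (prover B of unit `sr-gb-rung-b`,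
`GroundBartaEvenWinsBeyondArchEndpointLog5Half.lean`, 2026-08-23) is exactly the hypothesis of the CONDITIONAL
`(log 5)/2` line of this seat's `ζ`-transfer floor laws (`MinorantZetaTransfer.lean`, `…Odd.lean`, `…OddRungs.lean`)
and of the GL₂ level laws (`GL2LevelLaw.lean`, `GL2LevelLawParity{,Rungs}.lean`).  One `exact` each gives, now
UNCONDITIONALLY, on the closed three-prime window `[-(log 5)/2, (log 5)/2]` (primes `2, 3, 4` visible; `(log 5)/2 =
0.80471… > 4023/5000`, so every earlier rung follows by `WeilPositivityOnChar.mono`):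

* `weilPositivityOnChar_of_le_log5half[_of_le]` — the EVEN LAW up to `(log 5)/2`: `0 < t ≤ (log 5)/2`, `q ≠ 1`,
  `2(sinh t + t) ≤ log q` ⇒ `WeilPositivityOnChar χ t` for EVERY Dirichlet character `χ` mod `q`;
  `weilPositivityOnChar_odd_of_le_log5half_of_le` — the ODD LAW up to `(log 5)/2`;
* ★ `weilPositivityOnChar_log_five_half_of_ge_thirty : 30 ≤ q → ∀ χ, WeilPositivityOnChar χ ((log 5)/2)` (floor
  `⌈e^{2(sinh t + t)}⌉ = ⌈e^{3.3983}⌉ = 30`; exact all-trivial pseudo-key floor = 29, deposit trivial-key-minorant-CERT);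
  ★ `weilPositivityOnChar_log_five_half_of_odd_ge_fourteen : 14 ≤ q → charParity χ = 1 → …` (exact odd floor `14`);
  `weilPositivityOnChar_of_le_log5half_of_ge_thirty` — every window `t ≤ (log 5)/2` for every `χ` mod `q ≥ 30`;
* GL₂: `weilPositivityOnGL2_of_le_log5half_of_le` (plain level law `4(sinh t + t) ≤ log N₀ ≤ log N`, `t ≤ (log 5)/2`),
  ★ `weilPositivityOnGL2_log_five_half_of_ge_900` (plain law, level `900`), ★ `weilPositivityOnGL2_log_five_half_of_ge_420`
  (parity-bonus law `β = −1/4`, level `420`) — even weight `k ≥ 2`, `‖Λf n‖ ≤ 2Λ(n)`.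

Numerics: `e^{(log 5)/2} = √5 ≤ 2.236068` ⇒ `2(sinh t + t) ≤ 3.39831 ≤ log 30 = 3.40119…` (`RungLogBounds.log_thirty_ge`),
`4(sinh t + t) ≤ log 900 = 2 log 30`; parity budget `4(sinh t + t − t/2 + tanh(t/2)/16) ≤ 5.2830 ≤ (7/8) log 420 = 5.2852`.
The conditional lines for `83/100`, `9/10`, `(log 7)/2`, `1` of `MinorantZetaTransferOddRungs.lean` stay conditional.
Everything is PROVED; no definitions, no named facts; RH/GRH-free (a rung `WeilPositivityOnChar χ t` is ONE window of
Weil's criterion for `L(s, χ)`, necessary for `GRH(χ)`).  References: A. Weil (1952), (10)–(11) pp. 258–262 and the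
«lemme» p. 262 [Weil1952FormulesExplicites]; H. Yoshida (1992) §6 [Yoshida1992]; H. Iwaniec, E. Kowalski (2004)
Thm 5.12 [IwaniecKowalski2004].
-/

set_option autoImplicit false

noncomputable section

open Complex Set MeasureTheory Finset
open scoped Real ArithmeticFunction.vonMangoldt

namespace Summit.Ventures.WeilGRH

open Literature.NumberTheory.LFunctions
open Summit.RiemannHypothesis.RiemannHypothesis.Theorems.EvenWinsBeyondArch (weilPositivityOn_log5half
  weilPositivityOn_of_le_log5half)

variable {q : ℕ}

/-! ## The laws up to `(log 5)/2` -/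

/-- `0 < (log 5)/2`. [folklore] -/
theorem log_five_half_pos : 0 < Real.log 5 / 2 := by linarith [Real.log_five_gt_d9]

/-- ★ **The even law up to the three-prime window, unconditionally**: `0 < t ≤ (log 5)/2`, `q ≠ 1`,
`2(sinh t + t) ≤ log q` ⇒ `WeilPositivityOnChar χ t` for EVERY `χ` mod `q`. [folklore] -/
theorem weilPositivityOnChar_of_le_log5half {t : ℝ} (ht : 0 < t) (ht5 : t ≤ Real.log 5 / 2) (hq : q ≠ 1)
    (χ : DirichletCharacter ℂ q) (hL : 2 * (Real.sinh t + t) ≤ Real.log q) : WeilPositivityOnChar χ t :=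
  weilPositivityOnChar_of_weilPositivityOn ht (weilPositivityOn_of_le_log5half ht5) hq χ hL

/-- The same with an integer floor `Q ≤ q`, `2(sinh t + t) ≤ log Q`. [folklore] -/
theorem weilPositivityOnChar_of_le_log5half_of_le {t : ℝ} (ht : 0 < t) (ht5 : t ≤ Real.log 5 / 2) {Q : ℕ}
    (hQ : 2 * (Real.sinh t + t) ≤ Real.log Q) (hQq : Q ≤ q) (χ : DirichletCharacter ℂ q) :
    WeilPositivityOnChar χ t :=
  weilPositivityOnChar_of_weilPositivityOn_of_le ht (weilPositivityOn_of_le_log5half ht5) hQ hQq χ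

/-- ★ **The odd law up to the three-prime window, unconditionally**: `0 < t ≤ (log 5)/2`, `γ² < 1`,
`2(sinh t + t + 2γt + γ² tanh(t/2)) ≤ (1 − γ²) log Q`, `Q ≤ q`, `χ` odd ⇒ `WeilPositivityOnChar χ t`. [folklore] -/
theorem weilPositivityOnChar_odd_of_le_log5half_of_le {t : ℝ} (ht : 0 < t) (ht5 : t ≤ Real.log 5 / 2)
    {γ : ℝ} (hγ : γ ^ 2 < 1) {Q : ℕ}
    (hQ : 2 * (Real.sinh t + t + 2 * γ * t + γ ^ 2 * Real.tanh (t / 2)) ≤ (1 - γ ^ 2) * Real.log Q)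
    (hQq : Q ≤ q) (χ : DirichletCharacter ℂ q) (hodd : charParity χ = 1) : WeilPositivityOnChar χ t :=
  weilPositivityOnChar_odd_of_weilPositivityOn_of_le ht (weilPositivityOn_of_le_log5half ht5) hγ hQ hQq χ hodd

/-! ## The `(log 5)/2` floors: every `χ` mod `q ≥ 30`, every odd `χ` mod `q ≥ 14` -/

/-- ★★ **`(log 5)/2` for EVERY Dirichlet character of EVERY modulus `q ≥ 30`** (the `ζ` three-prime window rung
transferred; `30 = ⌈e^{2(sinh t + t)}⌉` is the floor of the reduction, the exact all-trivial pseudo-key floor is `29`).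
[folklore] -/
theorem weilPositivityOnChar_log_five_half_of_ge_thirty (hq : 30 ≤ q) (χ : DirichletCharacter ℂ q) :
    WeilPositivityOnChar χ (Real.log 5 / 2) :=
  ((weilPositivityOnChar_log_five_half_of_weilPositivityOn weilPositivityOn_log5half χ).1 hq)

/-- ★★ **`(log 5)/2` for EVERY ODD Dirichlet character of EVERY modulus `q ≥ 14`** (`= ` the exact odd pseudo-key
floor). [folklore] -/
theorem weilPositivityOnChar_log_five_half_of_odd_ge_fourteen (hq : 14 ≤ q) (χ : DirichletCharacter ℂ q)
    (hodd : charParity χ = 1) : WeilPositivityOnChar χ (Real.log 5 / 2) :=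
  ((weilPositivityOnChar_log_five_half_of_weilPositivityOn weilPositivityOn_log5half χ).2 hq hodd)

/-- Every window `t ≤ (log 5)/2` for every `χ` mod `q ≥ 30` (in particular the frontier `4023/5000`, `3/4`, `18/25`,
`log 2`, `59/100`, `(log 3)/2`, `2/5`, `(log 2)/2`). [folklore] -/
theorem weilPositivityOnChar_of_le_log5half_of_ge_thirty (hq : 30 ≤ q) (χ : DirichletCharacter ℂ q) {t : ℝ}
    (ht : t ≤ Real.log 5 / 2) : WeilPositivityOnChar χ t :=
  (weilPositivityOnChar_log_five_half_of_ge_thirty hq χ).mono ht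

/-- Every window `t ≤ (log 5)/2` for every odd `χ` mod `q ≥ 14`. [folklore] -/
theorem weilPositivityOnChar_of_le_log5half_of_odd_ge_fourteen (hq : 14 ≤ q) (χ : DirichletCharacter ℂ q)
    (hodd : charParity χ = 1) {t : ℝ} (ht : t ≤ Real.log 5 / 2) : WeilPositivityOnChar χ t :=
  (weilPositivityOnChar_log_five_half_of_odd_ge_fourteen hq χ hodd).mono ht

/-! ## GL₂: the level laws at `(log 5)/2` -/

/-- The GL₂ windows are monotone: positivity on `[−b, b]` gives positivity on `[−a, a]` for `a ≤ b`.
[cite: IwaniecKowalski2004, §5.5 Thm 5.12 (5.45) (positivity window)] -/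
theorem weilPositivityOnGL2_mono {k N : ℕ} {Λf : ℕ → ℂ} {a b : ℝ} (hab : a ≤ b)
    (h : WeilPositivityOnGL2 k N Λf b) : WeilPositivityOnGL2 k N Λf a :=
  fun g hg hga ↦ h g hg (hga.trans (Icc_subset_Icc (neg_le_neg hab) hab))

/-- **The plain GL₂ level law up to `(log 5)/2`, unconditionally**: even `k ≥ 2`, `‖Λf n‖ ≤ 2Λ(n)`, `0 < t ≤ (log 5)/2`,
`4(sinh t + t) ≤ log N₀`, `N₀ ≤ N` ⇒ `WeilPositivityOnGL2 k N Λf t`. [cite: IwaniecKowalski2004, §5.5 Thm 5.12 (5.45)] -/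
theorem weilPositivityOnGL2_of_le_log5half_of_le {k N : ℕ} {Λf : ℕ → ℂ} (hk : Even k) (hk2 : 2 ≤ k)
    (hΛ : ∀ n, ‖Λf n‖ ≤ 2 * Λ n) {t : ℝ} (ht : 0 < t) (ht5 : t ≤ Real.log 5 / 2) {N₀ : ℕ}
    (hN₀ : 4 * (Real.sinh t + t) ≤ Real.log N₀) (hle : N₀ ≤ N) : WeilPositivityOnGL2 k N Λf t :=
  weilPositivityOnGL2_of_weilPositivityOn_of_le hk hk2 hΛ ht (weilPositivityOn_of_le_log5half ht5) hN₀ hle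

/-- `4(sinh((log 5)/2) + (log 5)/2) ≤ log 900` (`= 2 log 30`). [folklore] -/
theorem four_mul_sinh_add_log_five_half_le_log :
    4 * (Real.sinh (Real.log 5 / 2) + Real.log 5 / 2) ≤ Real.log (900 : ℕ) := by
  have h := two_mul_sinh_add_log_five_half_le_log
  push_cast at h ⊢
  rw [show (900 : ℝ) = 30 ^ 2 by norm_num, Real.log_pow]
  push_cast
  linarith

/-- ★ **`(log 5)/2` for every GL₂ datum of level `N ≥ 900`** (even `k ≥ 2`, `‖Λf n‖ ≤ 2Λ(n)`; plain level law).
[cite: IwaniecKowalski2004, §5.5 Thm 5.12 (5.45)] -/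
theorem weilPositivityOnGL2_log_five_half_of_ge_900 {k N : ℕ} {Λf : ℕ → ℂ} (hk : Even k) (hk2 : 2 ≤ k)
    (hΛ : ∀ n, ‖Λf n‖ ≤ 2 * Λ n) (hN : 900 ≤ N) : WeilPositivityOnGL2 k N Λf (Real.log 5 / 2) :=
  weilPositivityOnGL2_of_le_log5half_of_le hk hk2 hΛ log_five_half_pos le_rfl
    four_mul_sinh_add_log_five_half_le_log hN

/-- Parity budget at `(log 5)/2`, `β = −1/4`: `4(sinh t + t − t/2 + tanh(t/2)/16) ≤ (7/8) log 420`. [folklore] -/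
theorem gl2_parity_budget_log_five_half :
    4 * (Real.sinh (Real.log 5 / 2) + Real.log 5 / 2 + 2 * (-1 / 4) * (Real.log 5 / 2) +
        (-1 / 4) ^ 2 * Real.tanh (Real.log 5 / 2 / 2)) ≤ (1 - 2 * (-1 / 4) ^ 2) * Real.log (420 : ℕ) := by
  have hs := sinh_le_of_exp_le exp_log_five_half_le
  have hth := tanh_half_le_of_exp_le exp_log_five_half_le
  have h7 := log_seven_ge_quarter
  have h5 := Real.log_five_lt_d9
  have h5' := Real.log_five_gt_d9
  have hl2v := Real.log_two_gt_d9
  have hl3v := Real.log_three_gt_d9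
  push_cast
  rw [show (420 : ℝ) = 2 ^ 2 * 3 * 5 * 7 by norm_num, Real.log_mul (by norm_num) (by norm_num),
    Real.log_mul (by norm_num) (by norm_num), Real.log_mul (by norm_num) (by norm_num), Real.log_pow]
  push_cast
  nlinarith

/-- ★ **`(log 5)/2` for every GL₂ datum of level `N ≥ 420`** (even `k ≥ 2`, `‖Λf n‖ ≤ 2Λ(n)`; parity-bonus law with
`β = −1/4`). [cite: IwaniecKowalski2004, §5.5 Thm 5.12 (5.45)] -/
theorem weilPositivityOnGL2_log_five_half_of_ge_420 {k N : ℕ} {Λf : ℕ → ℂ} (hk : Even k) (hk2 : 2 ≤ k)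
    (hΛ : ∀ n, ‖Λf n‖ ≤ 2 * Λ n) (hN : 420 ≤ N) : WeilPositivityOnGL2 k N Λf (Real.log 5 / 2) :=
  weilPositivityOnGL2_of_weilPositivityOn_parity_of_le hk hk2 hΛ log_five_half_pos weilPositivityOn_log5half
    (β := -1 / 4) (by norm_num) (by norm_num) gl2_parity_budget_log_five_half hN

/-- Every window `t ≤ (log 5)/2` for every GL₂ datum of level `N ≥ 420`. [cite: IwaniecKowalski2004, §5.5 Thm 5.12 (5.45)] -/
theorem weilPositivityOnGL2_of_le_log5half_of_ge_420 {k N : ℕ} {Λf : ℕ → ℂ} (hk : Even k) (hk2 : 2 ≤ k)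
    (hΛ : ∀ n, ‖Λf n‖ ≤ 2 * Λ n) (hN : 420 ≤ N) {t : ℝ} (ht : t ≤ Real.log 5 / 2) :
    WeilPositivityOnGL2 k N Λf t :=
  weilPositivityOnGL2_mono ht (weilPositivityOnGL2_log_five_half_of_ge_420 hk hk2 hΛ hN)

end Summit.Ventures.WeilGRH

end
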